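import Mathlib
import HarnessLib
import Summits.HubbardSuperconductivity.HubbardSuperconductivity.Theorems.KLProgrammeKLRegimeTwoVolumeSrcTowerBlock
import Summits.HubbardSuperconductivity.HubbardSuperconductivity.Theorems.KLProgrammeKLRegimeTwoVolumeSrcBlockStepDictF

/-!
# Route `KLProgramme` — crux K3, VL child `KLRegimeVolumeLimitV17F3` (stmt-HubbardSuperconductivity-23356), producer route «(VL)-SRC-SOFT» §S5b-2 at a
# GENERIC SOURCE FAMILY (cure of LR13′ «(VL)-HUV-CURRENCY-PROPAGATION», step F5b; seat hubbard-kl-k3c4-p1 g20; `--supports` 23356)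

Twin of `…TwoVolumeSrcTowerBlock.sourceProfilesAtLev_blockStep` (p674971) with the source copy analysed by an arbitrary one-sector family `F`
(`…TwoVolumeSourceProfileDefsF`): one block of the source-species tower — `SourceProfilesAtLevF (klSrcBudget P Q_R U A_k (k+1)) … F k k (k+1)` (+ E1's alive
read-out, the block data, the rows) ⇒ `SourceProfilesAtLevF (klSrcBudget P Q_o U A_out (k+ℓ+1)) … F (k+ℓ) (k+ℓ) (k+ℓ+1)`.  The plain proof verbatim with
`At ↦ AtF F` (S5a-F `…SrcBlockStepDictF.klSrcPinnedSumAtF_blockStep_le_twoScale`; the alive species is E1's read-out by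
`…SourceProfileKitF.klSrcPinnedSumAtF_zero_le_klWtPinnedSumAt`; the arithmetic `units_deg_two` / `blockRHS_le` / `blockLaw_absorb` of `…SrcTowerBlock` by name).

* **`sourceProfilesAtLevF_blockStep`** — the block step, source family `F`.

Proof only; no definition; nothing about the model's sizes is asserted beyond the hypotheses.
References: BGM 2006 §2.8 (2.77)–(2.83), §3 (3.2)–(3.8) [cite: BenfattoGiulianiMastropietro2006]; Gawȩdzki–Kupiainen 1985 §3 [cite: GawedzkiKupiainen1985GrossNeveu].
-/

noncomputable section

namespace Summit.HubbardSuperconductivity.HubbardSuperconductivity.Theorems.TwoVolumeDefect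

set_option linter.dupNamespace false -- summit = problem name (single-conjunct summit), D-0017

open Real Finset Literature.MathematicalPhysics.QuantumLattice GrassmannAlgebra Literature.Probability.LatticeModels
open Literature.Probability.LatticeModels.BattleFederbush
open Summit.HubbardSuperconductivity.HubbardSuperconductivity.Theorems.KLProgrammeLegKernels
open Summit.HubbardSuperconductivity.HubbardSuperconductivity.Theorems.KLRegimeSplit
open Summit.HubbardSuperconductivity.HubbardSuperconductivity.Theorems.EngineV8
open Summit.HubbardSuperconductivity.HubbardSuperconductivity.Theorems.TwoVolumeSource

variable {L M : ℕ} [NeZero L] [NeZero M]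

set_option maxHeartbeats 400000 in -- long binder block; many positivity side goals over a large context
open Classical in
/-- **ONE BLOCK OF THE SOURCE TOWER IN BUDGET LANGUAGE** (see the module docstring). [cite: BenfattoGiulianiMastropietro2006, §2.8 (2.77)-(2.83), §3 (3.2)-(3.8)] -/
theorem sourceProfilesAtLevF_blockStep {β : ℝ} (hβ : 0 < β) (U μ : ℝ) (K : TrigPolyC4v) (F : Fin 1 → FreqMomentum L M → ℂ) {k ℓ : ℕ} (hℓ : 1 ≤ ℓ)
    (P : SplitConsts) (hKl : 0 ≤ P.Klam) (Q₁ QR Qo : EngConsts) (hQ₁ : 0 ≤ Q₁.CE) (hR0 : 0 < QR.CE) (hQ₁R : Q₁.CE ≤ QR.CE) (hQo : 0 ≤ Qo.CE)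
    {C₀ t₀ lamMax : ℝ} (hC₀ : 0 ≤ C₀) (ht₀ : 0 < t₀) (ht₀1 : t₀ ≤ 1)
    (hlam0 : 0 < epsCoupling P U (k + 1)) (hlam : epsCoupling P U (k + 1) ≤ lamMax) (hlamMax1 : lamMax ≤ 1)
    (hZ : hubbardEffPartitionFnCT L M β U μ 0 K (klScale klE0 (k + 1)) ≠ 0)
    {Cκ Cb CJ CJ' θ : ℝ} (hCκ : 0 < Cκ) (hCb : 0 < Cb) (hθ : 0 < θ)
    {κ α cr cc : ℝ} (hκ : 0 < κ) (hσ8 : κ ^ 2 * (8 : ℝ) ^ (k + 1) = 2 * Cκ * klE0)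
    (hα : α = Cb * ((M : ℝ) / β) / klScale klE0 (k + 1 + ℓ))
    (hcr : cr = 81 * CJ * M / β) (hcc : cc = 81 * (2 : ℝ) ^ ℓ * CJ' * M / β)
    (hGB : IsGramBoundedR ((sectorSubMatrix L M β (bgmFatMultiplier L M klE0 β (nambuXiCT L μ K) k)).transpose *
      hubbardCovSliceCT L M β μ 0 K (klScale klE0 (k + 1 + ℓ)) (klScale klE0 (k + 1)) *
        sectorSubMatrix L M β (bgmFatMultiplier L M klE0 β (nambuXiCT L μ K) k)) κ)
    (hrow : ∀ X, ∑ Y, ‖((sectorSubMatrix L M β (bgmFatMultiplier L M klE0 β (nambuXiCT L μ K) k)).transpose *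
        hubbardCovSliceCT L M β μ 0 K (klScale klE0 (k + 1 + ℓ)) (klScale klE0 (k + 1)) *
          sectorSubMatrix L M β (bgmFatMultiplier L M klE0 β (nambuXiCT L μ K) k)) X Y‖ *
        klScaleWt L M β (k + ℓ) {latticeLegPos (2 * (2 * M)) X, latticeLegPos (2 * (2 * M)) Y} ≤ α)
    (hcol : ∀ Y, ∑ X, ‖((sectorSubMatrix L M β (bgmFatMultiplier L M klE0 β (nambuXiCT L μ K) k)).transpose *
        hubbardCovSliceCT L M β μ 0 K (klScale klE0 (k + 1 + ℓ)) (klScale klE0 (k + 1)) *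
          sectorSubMatrix L M β (bgmFatMultiplier L M klE0 β (nambuXiCT L μ K) k)) X Y‖ *
        klScaleWt L M β (k + ℓ) {latticeLegPos (2 * (2 * M)) X, latticeLegPos (2 * (2 * M)) Y} ≤ α)
    (hrow' : ∀ X'', ∑ X', ‖(sectorAnalysisMatrix L M β (klAnisoFamily L M β μ K klE0 (k + ℓ)) *
        sectorSubMatrix L M β (bgmFatMultiplier L M klE0 β (nambuXiCT L μ K) k)) X'' X'‖ *
        klScaleWt L M β (k + ℓ) {latticeLegPos (2 * (2 * M)) X'', latticeLegPos (2 * (2 * M)) X'} ≤ cr)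
    (hcol' : ∀ X', ∑ X'', ‖(sectorAnalysisMatrix L M β (klAnisoFamily L M β μ K klE0 (k + ℓ)) *
        sectorSubMatrix L M β (bgmFatMultiplier L M klE0 β (nambuXiCT L μ K) k)) X'' X'‖ *
        klScaleWt L M β (k + ℓ) {latticeLegPos (2 * (2 * M)) X'', latticeLegPos (2 * (2 * M)) X'} ≤ cc)
    -- the alive read-out at the block bottom (`stub_vl_HE1free`'s `S₀ k`)
    (S₀ : ℕ → ℝ) (hS₀0 : ∀ m, 0 ≤ S₀ m) (hS₀law : ∀ d, 1 ≤ d → S₀ (2 * d) ≤ C₀ * klWtBudget P Q₁ U (k + 1) (2 * d))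
    (hS₀read : ∀ (m : ℕ) (q : Fin m) (w : SpaceTimeIdx L M × SectorLeg (sectorCount k)),
      klWtPinnedSumAt L M β μ K k k m (klEffectiveAction L M β U μ K klE0 (k + 1)) q w ≤ S₀ m)
    -- token #24 at the block bottom
    {Ak : ℝ} (hAk : 0 ≤ Ak) (hin : SourceProfilesAtLevF L M (klSrcBudget P QR U (fun _ _ => Ak) (k + 1)) β U μ K F k k (k + 1))
    -- the rows of T2₂ at `λ_max` and the closed-form constants
    (hx₂ : 2 * lamMax * (Real.exp 1 ^ 4 * (1 + θ) ^ 2 * (2 * Cκ * klE0)) * QR.CE ≤ 1)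
    (hx₁ : 4 * (2 * Cκ * klE0) * lamMax * QR.CE ≤ 1 / 2)
    (hx₃ : Real.exp 1 * (Real.exp 1 ^ 4 * (1 + θ) ^ 2 * (2 * Cκ * klE0)) * lamMax * QR.CE ≤ 1 / 2)
    (hw : (256 * Real.exp 1 * Cb * (4 : ℝ) ^ ℓ / Cκ) * (2 * (Real.exp 1 ^ 4 * (1 + θ) ^ 2 * (2 * Cκ * klE0)) * QR.CE *
      (lamMax * (C₀ * Q₁.CE / (2 * QR.CE) + 2 * t₀ / 2) + (2 * t₀ / (2 * QR.CE) + C₀ * (Q₁.CE / QR.CE) ^ 2 + 2 * t₀))) ≤ 1 / 2)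
    (hV : (256 * Real.exp 1 * Cb * (4 : ℝ) ^ ℓ / Cκ) *
      (Real.exp 1 * (Real.exp 1 ^ 4 * (1 + θ) ^ 2 * (2 * Cκ * klE0)) * (lamMax * (C₀ * Q₁.CE + 2 * t₀ * QR.CE) + 2 * t₀) +
        4 * lamMax * (Real.exp 1 * (Real.exp 1 ^ 4 * (1 + θ) ^ 2 * (2 * Cκ * klE0))) ^ 2 * (C₀ * Q₁.CE ^ 2 + 2 * t₀ * QR.CE ^ 2)) ≤ 1 / 2)
    -- the output per-pair constant and amplitude
    (hQoR : max (81 * (2 : ℝ) ^ ℓ * CJ' / 2) 1 ^ 2 * max 4 (2 * (Real.exp 1 ^ 4 * (1 + θ) ^ 2 * (2 * Cκ * klE0)) * (1 / (θ ^ 2 * (2 * Cκ * klE0)))) *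
      QR.CE ≤ (8 : ℝ) ^ ℓ * Qo.CE)
    {Aout : ℝ}
    (hAout : (16 : ℝ) ^ (k + 1) * (max 1 Ak) ^ 2 / t₀ ^ 2 *
      (max (81 * CJ / 2) 1 * max (81 * (2 : ℝ) ^ ℓ * CJ' / 2) 1 * (2 : ℝ) ^ (5 * ℓ) *
        (max 4 (2 * (Real.exp 1 ^ 4 * (1 + θ) ^ 2 * (2 * Cκ * klE0)) * (1 / (θ ^ 2 * (2 * Cκ * klE0)))) * QR.CE *
            ((C₀ + 2 * t₀) * (1 + 8 * (2 * Cκ * klE0) * QR.CE) +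
              Real.exp 1 * (C₀ * Q₁.CE / (2 * QR.CE) + 2 * t₀ / 2 + (2 * t₀ / (2 * QR.CE) + C₀ * (Q₁.CE / QR.CE) ^ 2 + 2 * t₀))) +
          ((C₀ + 2 * t₀) * (1 + 8 * (2 * Cκ * klE0) * QR.CE) +
              Real.exp 1 * (C₀ * Q₁.CE / (2 * QR.CE) + 2 * t₀ / 2 + (2 * t₀ / (2 * QR.CE) + C₀ * (Q₁.CE / QR.CE) ^ 2 + 2 * t₀))) +
          2 * t₀)) ≤ Aout) :
    SourceProfilesAtLevF L M (klSrcBudget P Qo U (fun _ _ => Aout) (k + ℓ + 1)) β U μ K F (k + ℓ) (k + ℓ) (k + ℓ + 1) := by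
  have hβ0 : 0 ≤ β := hβ.le
  have hβne : β ≠ 0 := hβ.ne'
  have he : (0 : ℝ) < klE0 := by norm_num [klE0]
  -- abbreviations for the closed-form constants
  set σc : ℝ := 2 * Cκ * klE0 with hσc
  set τc : ℝ := Real.exp 1 ^ 4 * (1 + θ) ^ 2 * (2 * Cκ * klE0) with hτc
  set ψc : ℝ := 1 / (θ ^ 2 * (2 * Cκ * klE0)) with hψc
  set Φc : ℝ := 256 * Real.exp 1 * Cb * (4 : ℝ) ^ ℓ / Cκ with hΦc
  set R : ℝ := QR.CE with hRdef
  set lam : ℝ := epsCoupling P U (k + 1) with hlamdef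
  set Γ : ℝ := max 4 (2 * τc * ψc) with hΓ
  set cr' : ℝ := max (81 * CJ / 2) 1 with hcr'
  set cc' : ℝ := max (81 * (2 : ℝ) ^ ℓ * CJ' / 2) 1 with hcc'
  set ζb : ℝ := C₀ * Q₁.CE / (2 * R) + 2 * t₀ / 2 + (2 * t₀ / (2 * R) + C₀ * (Q₁.CE / R) ^ 2 + 2 * t₀) with hζb
  set Kb : ℝ := (C₀ + 2 * t₀) * (1 + 8 * σc * R) + Real.exp 1 * ζb with hKb
  have hσ0 : 0 < σc := by positivity
  have hτ0 : 0 < τc := by positivity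
  have hψ0 : 0 < ψc := by positivity
  have hΦ0 : 0 < Φc := by positivity
  have hΓ1 : 1 ≤ Γ := le_trans (by norm_num) (le_max_left _ _)
  have hcr'1 : 1 ≤ cr' := le_max_right _ _
  have hcc'1 : 1 ≤ cc' := le_max_right _ _
  have hζb0 : 0 ≤ ζb := by positivity
  have hKb0 : 0 ≤ Kb := by positivity
  have hlam1 : lam ≤ 1 := hlam.trans hlamMax1
  -- units of the block bottom
  set u : ℝ := (8 : ℝ) ^ (k + 1) with hu
  set Kc : ℝ := ((2 : ℝ) ^ (5 * (k + 1)))⁻¹ with hKc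
  have hu0 : 0 < u := by positivity
  have hKc0 : 0 < Kc := by positivity
  have hKcu : Kc * u = ((4 : ℝ) ^ (k + 1))⁻¹ := units_deg_two (k + 1)
  have h4k : 0 < (4 : ℝ) ^ (k + 1) := by positivity
  -- the source rescaling of this block
  set Ak' : ℝ := max 1 Ak with hAk'
  have hAk'1 : 1 ≤ Ak' := le_max_left _ _
  have hAkle : Ak ≤ Ak' := le_max_right _ _
  have hAk'0 : 0 < Ak' := lt_of_lt_of_le one_pos hAk'1
  set t : ℝ := t₀ / ((4 : ℝ) ^ (k + 1) * Ak') with htdef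
  have h4A : 0 < (4 : ℝ) ^ (k + 1) * Ak' := mul_pos h4k hAk'0
  have ht : 0 < t := div_pos ht₀ h4A
  have ht1 : t ≤ 1 := by
    rw [htdef, div_le_one h4A]
    exact ht₀1.trans (one_le_mul_of_one_le_of_one_le (one_le_pow₀ (by norm_num)) hAk'1)
  have htAk' : t * Ak' = t₀ * ((4 : ℝ) ^ (k + 1))⁻¹ := by
    rw [htdef]; field_simp
  have htA : (t + t ^ 2) * Ak ≤ 2 * t₀ * ((4 : ℝ) ^ (k + 1))⁻¹ := by
    have h1 : t ^ 2 ≤ t := by rw [pow_two]; exact (mul_le_mul_of_nonneg_left ht1 ht.le).trans_eq (mul_one t)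
    have h2 : t + t ^ 2 ≤ 2 * t := by rw [two_mul]; exact add_le_add le_rfl h1
    calc (t + t ^ 2) * Ak ≤ (2 * t) * Ak := mul_le_mul_of_nonneg_right h2 hAk
      _ ≤ (2 * t) * Ak' := mul_le_mul_of_nonneg_left hAkle (by positivity)
      _ = 2 * t₀ * ((4 : ℝ) ^ (k + 1))⁻¹ := by rw [mul_assoc, htAk', mul_assoc]
  have htinv : t⁻¹ ^ 2 = (16 : ℝ) ^ (k + 1) * Ak' ^ 2 / t₀ ^ 2 := by
    rw [htdef, inv_div, div_pow, mul_pow, ← pow_mul, show (4 : ℝ) ^ ((k + 1) * 2) = 16 ^ (k + 1) by rw [mul_comm, pow_mul]; norm_num]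
  -- the input sizes of S5a: alive copy `S₀`, source copies at token #24's budget
  set S : ℕ → ℕ → ℝ := fun s m => if s = 0 then S₀ m else klSrcBudget P QR U (fun _ _ => Ak) (k + 1) s m with hSdef
  have hS0 : ∀ s m, 0 ≤ S s m := fun s m => by
    simp only [hSdef]; split_ifs
    · exact hS₀0 m
    · exact klSrcBudget_nonneg hR0.le hKl U (fun _ _ => hAk) _ _ _
  have hS : ∀ s, s < 3 → ∀ (m : ℕ) (q : Fin m) (w : SrcLabel L M k), klSrcPinnedSumAtF L M β U μ K F k (k + ℓ) (k + 1) s m q w ≤ S s m := by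
    intro s hs m q w
    have hrate := klSrcPinnedSumAtF_anti_rate hβ0 U μ K F k (k + 1) s m (Nat.le_add_right k ℓ) q w
    refine hrate.trans ?_
    rcases s with _ | s
    · simp only [hSdef, if_true]
      exact (klSrcPinnedSumAtF_zero_le_klWtPinnedSumAt hβ0 U μ K F k k (k + 1) m q w).trans (hS₀read m q w.1)
    · simp only [hSdef, Nat.succ_ne_zero, if_false]
      exact hin (s + 1) (by omega) (by omega) m q w
  -- the two-scale profile of the input: `(C, Q, A, a) := (C₀, Q₁.CE, 2t₀, 2t₀)`
  have h4inv1 : ((4 : ℝ) ^ (k + 1))⁻¹ ≤ 1 := inv_le_one_of_one_le₀ (one_le_pow₀ (by norm_num))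
  have hprof : ∀ d, 1 ≤ d → S 0 (2 * d) + t * S 1 (2 * d) + t ^ 2 * S 2 (2 * d) ≤
      ((2 : ℝ) ^ (5 * (k + 1)))⁻¹ * ((8 : ℝ) ^ (k + 1)) ^ d *
        (lam ^ max 1 (d - 1) * (C₀ * Q₁.CE ^ d + 2 * t₀ * R ^ d) + (if d = 1 then 2 * t₀ else 0)) := by
    intro d hd
    have hS0d : S 0 (2 * d) ≤ C₀ * (Kc * u ^ d * (Q₁.CE ^ d * lam ^ max 1 (d - 1))) := by
      have h := hS₀law d hd
      rw [klWtBudget_two_mul_units] at h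
      have hS0e : S 0 (2 * d) = S₀ (2 * d) := by simp [hSdef]
      rw [hS0e]; exact h
    have hS12 : ∀ s, s ≠ 0 → S s (2 * d) = Ak * (if 2 * d ≤ 2 then 1 else klWtBudget P QR U (k + 1) (2 * d)) := by
      intro s hs; simp only [hSdef, hs, if_false, klSrcBudget]
    have hle : lam ^ max 1 (d - 1) * (C₀ * Q₁.CE ^ d) + 2 * t₀ * (lam ^ max 1 (d - 1) * R ^ d) * ((4 : ℝ) ^ (k + 1))⁻¹ ≤
        lam ^ max 1 (d - 1) * (C₀ * Q₁.CE ^ d + 2 * t₀ * R ^ d) := by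
      have h0 : 0 ≤ 2 * t₀ * (lam ^ max 1 (d - 1) * R ^ d) := by positivity
      calc lam ^ max 1 (d - 1) * (C₀ * Q₁.CE ^ d) + 2 * t₀ * (lam ^ max 1 (d - 1) * R ^ d) * ((4 : ℝ) ^ (k + 1))⁻¹
          ≤ lam ^ max 1 (d - 1) * (C₀ * Q₁.CE ^ d) + 2 * t₀ * (lam ^ max 1 (d - 1) * R ^ d) := add_le_add le_rfl (mul_le_of_le_one_right h0 h4inv1)
        _ = lam ^ max 1 (d - 1) * (C₀ * Q₁.CE ^ d + 2 * t₀ * R ^ d) := by ring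
    rcases Nat.lt_or_ge d 2 with hd1 | hd2
    · obtain rfl : d = 1 := by omega
      have e1 : S 1 (2 * 1) = Ak := by rw [hS12 1 one_ne_zero, if_pos (by norm_num), mul_one]
      have e2 : S 2 (2 * 1) = Ak := by rw [hS12 2 two_ne_zero, if_pos (by norm_num), mul_one]
      rw [e1, e2, if_pos rfl]
      have h1 : t * Ak + t ^ 2 * Ak ≤ 2 * t₀ * ((4 : ℝ) ^ (k + 1))⁻¹ := by rw [← add_mul]; exact htA
      calc S 0 (2 * 1) + t * Ak + t ^ 2 * Ak ≤ C₀ * (Kc * u ^ 1 * (Q₁.CE ^ 1 * lam ^ max 1 (1 - 1))) + 2 * t₀ * ((4 : ℝ) ^ (k + 1))⁻¹ := by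
            rw [add_assoc]; exact add_le_add hS0d h1
        _ = Kc * u ^ 1 * (lam ^ max 1 (1 - 1) * (C₀ * Q₁.CE ^ 1) + 2 * t₀) := by rw [pow_one u, ← hKcu]; ring
        _ ≤ Kc * u ^ 1 * (lam ^ max 1 (1 - 1) * (C₀ * Q₁.CE ^ 1 + 2 * t₀ * R ^ 1) + 2 * t₀) := by
            refine mul_le_mul_of_nonneg_left (add_le_add ?_ le_rfl) (by positivity)
            exact mul_le_mul_of_nonneg_left (le_add_of_nonneg_right (by positivity)) (by positivity)
    · rw [hS12 1 one_ne_zero, hS12 2 two_ne_zero, if_neg (by omega), if_neg (by omega), klWtBudget_two_mul_units, add_zero]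
      have h1 : t * (Ak * (((2 : ℝ) ^ (5 * (k + 1)))⁻¹ * ((8 : ℝ) ^ (k + 1)) ^ d * (QR.CE ^ d * epsCoupling P U (k + 1) ^ max 1 (d - 1)))) +
          t ^ 2 * (Ak * (((2 : ℝ) ^ (5 * (k + 1)))⁻¹ * ((8 : ℝ) ^ (k + 1)) ^ d * (QR.CE ^ d * epsCoupling P U (k + 1) ^ max 1 (d - 1)))) =
          ((t + t ^ 2) * Ak) * (Kc * u ^ d * (R ^ d * lam ^ max 1 (d - 1))) := by ring
      rw [add_assoc, h1]
      have h2 : ((t + t ^ 2) * Ak) * (Kc * u ^ d * (R ^ d * lam ^ max 1 (d - 1))) ≤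
          (2 * t₀ * ((4 : ℝ) ^ (k + 1))⁻¹) * (Kc * u ^ d * (R ^ d * lam ^ max 1 (d - 1))) := mul_le_mul_of_nonneg_right htA (by positivity)
      calc S 0 (2 * d) + (t + t ^ 2) * Ak * (Kc * u ^ d * (R ^ d * lam ^ max 1 (d - 1)))
          ≤ C₀ * (Kc * u ^ d * (Q₁.CE ^ d * lam ^ max 1 (d - 1))) + (2 * t₀ * ((4 : ℝ) ^ (k + 1))⁻¹) * (Kc * u ^ d * (R ^ d * lam ^ max 1 (d - 1))) :=
            add_le_add hS0d h2
        _ = Kc * u ^ d * (lam ^ max 1 (d - 1) * (C₀ * Q₁.CE ^ d) + 2 * t₀ * (lam ^ max 1 (d - 1) * R ^ d) * ((4 : ℝ) ^ (k + 1))⁻¹) := by ring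
        _ ≤ Kc * u ^ d * (lam ^ max 1 (d - 1) * (C₀ * Q₁.CE ^ d + 2 * t₀ * R ^ d)) := mul_le_mul_of_nonneg_left hle (by positivity)
  -- the rows at the block's own `λ = ε_{k+1} ≤ λ_max`
  have hR0' : 0 ≤ R := hR0.le
  have hz₀0 : 0 ≤ C₀ * Q₁.CE / (2 * R) + 2 * t₀ / 2 := by positivity
  have hx₂' : 2 * lam * τc * R ≤ 1 := le_trans (by gcongr) hx₂
  have hx₁' : 4 * σc * lam * R ≤ 1 / 2 := le_trans (by gcongr) hx₁
  have hx₃' : Real.exp 1 * τc * lam * R ≤ 1 / 2 := le_trans (by gcongr) hx₃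
  have hw' : Φc * (2 * τc * R * (lam * (C₀ * Q₁.CE / (2 * R) + 2 * t₀ / 2) + (2 * t₀ / (2 * R) + C₀ * (Q₁.CE / R) ^ 2 + 2 * t₀))) ≤ 1 / 2 :=
    le_trans (by gcongr) hw
  have hV' : Φc * (Real.exp 1 * τc * (lam * (C₀ * Q₁.CE + 2 * t₀ * R) + 2 * t₀) + 4 * lam * (Real.exp 1 * τc) ^ 2 * (C₀ * Q₁.CE ^ 2 + 2 * t₀ * R ^ 2)) ≤ 1 / 2 :=
    le_trans (by gcongr) hV
  -- the output amplitude is nonnegative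
  have htinv1 : 1 ≤ t⁻¹ := (one_le_inv₀ ht).2 ht1
  have hAout0 : 0 ≤ Aout := le_trans (by positivity) hAout
  have hAkk : t⁻¹ ^ 2 * cr' * cc' * (2 : ℝ) ^ (5 * ℓ) * Kb ≤ Aout := by
    refine le_trans ?_ hAout
    rw [← htinv]
    have h1 : Kb ≤ Γ * R * Kb + Kb + 2 * t₀ := by
      have hx : 0 ≤ Γ * R * Kb := mul_nonneg (mul_nonneg (zero_le_one.trans hΓ1) hR0') hKb0
      have hy : 0 ≤ 2 * t₀ := by positivity
      calc Kb = 0 + Kb + 0 := by ring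
        _ ≤ Γ * R * Kb + Kb + 2 * t₀ := add_le_add (add_le_add hx le_rfl) hy
    calc t⁻¹ ^ 2 * cr' * cc' * (2 : ℝ) ^ (5 * ℓ) * Kb = t⁻¹ ^ 2 * (cr' * cc' * (2 : ℝ) ^ (5 * ℓ) * Kb) := by ring
      _ ≤ t⁻¹ ^ 2 * (cr' * cc' * (2 : ℝ) ^ (5 * ℓ) * (Γ * R * Kb + Kb + 2 * t₀)) := by gcongr
  have hAk0 : t⁻¹ ^ 2 * (cr' * cc') * (Γ * R * Kb + 2 * t₀) ≤ Aout := by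
    refine le_trans ?_ hAout
    rw [← htinv]
    have h25 : (1 : ℝ) ≤ (2 : ℝ) ^ (5 * ℓ) := one_le_pow₀ (by norm_num)
    have h1 : Γ * R * Kb + 2 * t₀ ≤ Γ * R * Kb + Kb + 2 * t₀ := by
      calc Γ * R * Kb + 2 * t₀ = Γ * R * Kb + 0 + 2 * t₀ := by ring
        _ ≤ Γ * R * Kb + Kb + 2 * t₀ := add_le_add (add_le_add le_rfl hKb0) le_rfl
    calc t⁻¹ ^ 2 * (cr' * cc') * (Γ * R * Kb + 2 * t₀) ≤ t⁻¹ ^ 2 * (cr' * cc') * (Γ * R * Kb + Kb + 2 * t₀) := by gcongr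
      _ ≤ t⁻¹ ^ 2 * (cr' * cc') * (Γ * R * Kb + Kb + 2 * t₀) * (2 : ℝ) ^ (5 * ℓ) := le_mul_of_one_le_right (by positivity) h25
      _ = t⁻¹ ^ 2 * (cr' * cc' * (2 : ℝ) ^ (5 * ℓ) * (Γ * R * Kb + Kb + 2 * t₀)) := by ring
  -- the conclusion, degree by degree
  intro s hs1 hs2 m q w
  rcases Nat.even_or_odd m with ⟨d, hm⟩ | hodd
  swap
  · rw [klSrcPinnedSumAtF_eq_zero_of_odd hβne U μ K F (k + ℓ) (k + ℓ) (k + ℓ + 1) s hodd q w]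
    exact klSrcBudget_nonneg hQo hKl U (fun _ _ => hAout0) _ _ _
  rcases Nat.eq_zero_or_pos d with hd0 | hdpos
  · subst hd0; exact absurd q.2 (by omega)
  obtain ⟨q', rfl⟩ : ∃ q', d = q' + 1 := ⟨d - 1, by omega⟩
  obtain rfl : m = 2 * (q' + 1) := by omega
  -- S5a at this block
  have key := klSrcPinnedSumAtF_blockStep_le_twoScale (L := L) (M := M) hβ U μ K F (k := k) (ℓ := ℓ) (J' := k + ℓ) (by omega) (k + ℓ) hZ
    hCκ hCb hθ hκ hσ8 hα hcr (cc := cc) (CJ' := CJ') (by rw [Nat.add_sub_cancel_left]; exact hcc) hGB hrow hcol hrow' hcol'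
    S hS0 hS ht hlam0 hR0 hQ₁ hQ₁R hC₀ (by positivity : (0 : ℝ) ≤ 2 * t₀) (by positivity : (0 : ℝ) ≤ 2 * t₀) hprof
    hx₂' hx₁' hx₃' hw' hV' (s := s) (by omega) q' q w
  rw [show k + 1 + ℓ = k + ℓ + 1 by omega] at key
  simp only [Nat.add_sub_cancel_left] at key
  rw [← hτc, ← hψc, ← hΦc, ← hσc, ← hcr', ← hcc'] at key
  -- the right side absorbed
  have hSg : S 0 (2 * (q' + 1)) + t * S 1 (2 * (q' + 1)) + t ^ 2 * S 2 (2 * (q' + 1)) ≤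
      Kc * u ^ (q' + 1) * (lam ^ max 1 q' * (C₀ * Q₁.CE ^ (q' + 1) + 2 * t₀ * R ^ (q' + 1)) + (if q' + 1 = 1 then 2 * t₀ else 0)) := by
    have h := hprof (q' + 1) (by omega)
    simp only [Nat.add_sub_cancel] at h
    exact h
  have hSig := blockRHS_le (q := q') (σ := σc) (τ := τc) (ψ := ψc) (Φ := Φc) hC₀ (by positivity : (0 : ℝ) ≤ 2 * t₀) hQ₁ hQ₁R hlam0.le hlam1
    hσ0.le hτ0.le hψ0.le hΦ0.le (by positivity : 0 ≤ Kc * u ^ (q' + 1)) hz₀0 (by positivity : 0 ≤ 2 * t₀ / (2 * R) + C₀ * (Q₁.CE / R) ^ 2 + 2 * t₀)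
    hSg hw'
  have hpre0 : 0 ≤ t⁻¹ ^ s * (cr' * cc' ^ (2 * q' + 1)) := by positivity
  have hout := key.trans (mul_le_mul_of_nonneg_left hSig hpre0)
  rw [← hΓ, ← hζb, ← hKb] at hout
  rcases Nat.eq_zero_or_pos q' with hq0 | hqpos
  · -- degree two: budget-free
    subst hq0
    rw [klSrcBudget_of_le_two P Qo U _ _ s (by norm_num)]
    refine hout.trans ?_
    rw [if_pos rfl]
    have hts : t⁻¹ ^ s ≤ t⁻¹ ^ 2 := pow_le_pow_right₀ htinv1 hs2
    calc t⁻¹ ^ s * (cr' * cc' ^ (2 * 0 + 1)) * (Kc * u ^ (0 + 1) * (lam ^ 0 * ((Γ * R) ^ (0 + 1) * Kb) + 2 * t₀))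
        = t⁻¹ ^ s * (cr' * cc') * ((Kc * u) * (Γ * R * Kb + 2 * t₀)) := by ring
      _ ≤ t⁻¹ ^ 2 * (cr' * cc') * (1 * (Γ * R * Kb + 2 * t₀)) := by
          rw [hKcu]
          exact mul_le_mul (mul_le_mul_of_nonneg_right hts (by positivity)) (mul_le_mul_of_nonneg_right h4inv1 (by positivity))
            (by positivity) (by positivity)
      _ = t⁻¹ ^ 2 * (cr' * cc') * (Γ * R * Kb + 2 * t₀) := by rw [one_mul]
      _ ≤ Aout := hAk0
  · -- degree `2(q′+1) ≥ 4`: law-shaped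
    rw [klSrcBudget_of_two_lt P Qo U _ _ s (by omega), klWtBudget_two_mul_units, Nat.add_sub_cancel, max_eq_right hqpos]
    rw [if_neg (by omega), add_zero] at hout
    refine hout.trans ?_
    have hlamO : lam ≤ epsCoupling P U (k + ℓ + 1) := epsCoupling_mono hKl U (by omega)
    have hQo' : cc' ^ 2 * Γ * R ≤ (8 : ℝ) ^ ℓ * Qo.CE := hQoR
    have hunits : ((2 : ℝ) ^ (5 * (k + ℓ + 1)))⁻¹ * ((8 : ℝ) ^ (k + ℓ + 1)) ^ (q' + 1) = (Kc * ((2 : ℝ) ^ (5 * ℓ))⁻¹) * (u * (8 : ℝ) ^ ℓ) ^ (q' + 1) := by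
      rw [hKc, hu]; ring
    rw [hunits]
    have h := blockLaw_absorb (q := q') (ℓ := ℓ) (s := s) (Kc := Kc) (u := u) htinv1 hs2 (zero_le_one.trans hcr'1) hcc'1 hKc0.le hu0.le hlam0.le hlamO
      (zero_le_one.trans hΓ1) hR0' hKb0 hQo' hAkk
    refine h.trans (le_of_eq ?_)
    ring

end Summit.HubbardSuperconductivity.HubbardSuperconductivity.Theorems.TwoVolumeDefect

end
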